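import Mathlib
import Literature.MathematicalPhysics.QuantumFieldTheory.Balaban1983to89.B10

/-!
# Route `CoarseStiffnessTail` (rev 1 «unit-poly-tail») — crux `UnitPolyTailL` (stmt-QuantumFields-24027), LINE 20 skeleton
# `Cruxes/HistoryTailL/Lines/unit_poly_tail.lean`: the registered stub `stub_absorbRate` (ABSORPTION RATE), PROVED

Prover seat `ym-line-cst-p1` (g23).  The LINE-20 skeleton (ideator `ym-r3-idea-2` g10) cuts the deciding crux S1_poly = `UnitPolyTailL`
(power-law unit-scale single-plaquette tail, uniform in the cut-off) into the ORGAN `stub_topTailDegraded` (XL: the top-slice tail in the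
DEGRADED-GAUSSIAN format `C·γ^(−A)·exp(−c·p(√γ)² + κ·(1 + log(√γ)⁻¹)^q)`, `q < 2p₀`) and the ABSORPTION RATE `stub_absorbRate` (M, pure real
analysis): that format is below `C'·γ^s` for some `s > 3` once `γ` is small.  This file proves the second stub EXACTLY as registered
(`ledger workitem stubs stmt-QuantumFields-24027`), with `s = 4`, `C' = C`.

THE ARGUMENT.  Write `u = log γ⁻¹ ≥ 0` and `v = 1 + log(√γ)⁻¹ = 1 + u/2 ≥ 1`, so that `p(√γ) = b₀·v^{p₀}` ([Balaban1985UV3] (7) p.257: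
`p(g) = b₀(1 + log g⁻¹)^{p₀}`), `γ^(−A) = e^{Au}` and `γ^4 = e^{−4u}`.  The claim `C·e^{Au}·exp(−c·b₀²·v^{2p₀} + κ·v^q) ≤ C·e^{−4u}` follows from
`(A + 4)·u + κ·v^q ≤ c·b₀²·v^{2p₀}`; with `M = max(A + 4, 0)` and `u = 2(v − 1) ≤ 2v` it suffices that `2M·v ≤ (c·b₀²/2)·v^{2p₀}` and
`κ·v^q ≤ (c·b₀²/2)·v^{2p₀}`, i.e. `4M/(c·b₀²) ≤ v^{2p₀−1}` and `2κ/(c·b₀²) ≤ v^{2p₀−q}` — both hold for `v ≥ v₀` because the exponents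
`2p₀ − 1 > 3` and `2p₀ − q > 0` are positive (`Real.tendsto_rpow_atTop`); `v ≥ v₀ ≥ 1` is `γ ≤ γ₀ := exp(−2(v₀ − 1)) ≤ 1`.

HONEST FRAMING.  Elementary real analysis; no measure, no lattice, nothing of [Balaban1985UV3] is proved.  The organ `stub_topTailDegraded`,
the crux `UnitPolyTailL`, `HistoryTailL` (stmt-QuantumFields-19936) and the rung `YM3TorusSU2` (R3, a RECORD rung, NOT the Clay statement)
stay OPEN; the Yang–Mills mass gap is not touched.

References: [Balaban1985UV3] T. Bałaban, Commun. Math. Phys. **102** (1985) 255–275, (7) p.257.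
-/

set_option autoImplicit false

noncomputable section

namespace Summit.QuantumFields.YangMills.Theorems.CoarseStiffnessTailUnitPolyTailLAbsorbRate

open Filter
open Literature.MathematicalPhysics.QuantumFieldTheory.Balaban1983to89

/-- For a positive exponent `e` and any threshold `T`, eventually (in `v → ∞`) `T ≤ v^e`. [folklore] -/
theorem eventually_le_rpow {e : ℝ} (he : 0 < e) (T : ℝ) : ∀ᶠ v : ℝ in atTop, T ≤ v ^ e :=
  (tendsto_rpow_atTop he).eventually_ge_atTop T

/-- `p(√γ) = b₀·(1 + ½·log γ⁻¹)^{p₀}` — the unit-scale window exponent in the variable `u = log γ⁻¹` (`0 < γ`).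
[cite: Balaban1985UV3, (7) p.257] -/
theorem pFun_sqrt_eq {b₀ p₀ γ : ℝ} (hγ : 0 < γ) :
    B10.pFun b₀ p₀ (Real.sqrt γ) = b₀ * (1 + Real.log γ⁻¹ / 2) ^ p₀ := by
  unfold B10.pFun
  rw [Real.log_inv, Real.log_sqrt hγ.le, Real.log_inv]
  ring_nf

/-- The key real inequality behind the absorption: for `0 < b₀`, `2 < p₀`, `0 < c`, `q < 2p₀` and any `κ`, `A` there is `v₀ ≥ 1` such that
`(A + 4)·(2(v − 1)) + κ·v^q ≤ c·(b₀·v^{p₀})²` for every `v ≥ v₀` (the sign of `κ` is not needed). [folklore] -/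
theorem linear_add_rpow_le_sq {b₀ p₀ c q : ℝ} (κ A : ℝ) (hb₀ : 0 < b₀) (hp₀ : 2 < p₀) (hc : 0 < c) (hq : q < 2 * p₀) :
    ∃ v₀ : ℝ, 1 ≤ v₀ ∧ ∀ v : ℝ, v₀ ≤ v → (A + 4) * (2 * (v - 1)) + κ * v ^ q ≤ c * (b₀ * v ^ p₀) ^ 2 := by
  set M : ℝ := max (A + 4) 0 with hMdef
  have hM0 : 0 ≤ M := le_max_right _ _
  have hMA : A + 4 ≤ M := le_max_left _ _
  have hcb : 0 < c * b₀ ^ 2 := by positivity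
  have he₁ : 0 < 2 * p₀ - 1 := by linarith
  have he₂ : 0 < 2 * p₀ - q := by linarith
  have hev : ∀ᶠ v : ℝ in atTop, 1 ≤ v ∧ 4 * M / (c * b₀ ^ 2) ≤ v ^ (2 * p₀ - 1) ∧ 2 * κ / (c * b₀ ^ 2) ≤ v ^ (2 * p₀ - q) :=
    (eventually_ge_atTop 1).and ((eventually_le_rpow he₁ _).and (eventually_le_rpow he₂ _))
  obtain ⟨v₁, hv₁⟩ := hev.exists_forall_of_atTop
  refine ⟨max v₁ 1, le_max_right _ _, fun v hv => ?_⟩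
  obtain ⟨hv1, hT₁, hT₂⟩ := hv₁ v ((le_max_left _ _).trans hv)
  have hv0 : 0 < v := zero_lt_one.trans_le hv1
  -- `v^{2p₀} = v^{2p₀-1}·v = v^{2p₀-q}·v^q` and `(b₀ v^{p₀})² = b₀² v^{2p₀}`
  have hsplit₁ : v ^ (2 * p₀) = v ^ (2 * p₀ - 1) * v := by
    conv_lhs => rw [show 2 * p₀ = (2 * p₀ - 1) + 1 by ring]
    rw [Real.rpow_add hv0, Real.rpow_one]
  have hsplit₂ : v ^ (2 * p₀) = v ^ (2 * p₀ - q) * v ^ q := by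
    conv_lhs => rw [show 2 * p₀ = (2 * p₀ - q) + q by ring]
    rw [Real.rpow_add hv0]
  have hvp : (v ^ p₀) ^ (2 : ℕ) = v ^ (2 * p₀) := by
    rw [← Real.rpow_natCast, ← Real.rpow_mul hv0.le]
    congr 1
    push_cast
    ring
  have hsq : (b₀ * v ^ p₀) ^ 2 = b₀ ^ 2 * v ^ (2 * p₀) := by rw [mul_pow, hvp]
  have hvq0 : 0 ≤ v ^ q := Real.rpow_nonneg hv0.le q
  -- linear term: `(A+4)·2(v-1) ≤ 2M v ≤ (c b₀²/2) v^{2p₀}`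
  have hlin : (A + 4) * (2 * (v - 1)) ≤ c * b₀ ^ 2 / 2 * v ^ (2 * p₀) := by
    have h1 : (A + 4) * (2 * (v - 1)) ≤ M * (2 * (v - 1)) :=
      mul_le_mul_of_nonneg_right hMA (by linarith)
    have h2 : M * (2 * (v - 1)) ≤ 2 * M * v := by nlinarith
    have h3 : 2 * M * v ≤ c * b₀ ^ 2 / 2 * (v ^ (2 * p₀ - 1) * v) := by
      rw [div_le_iff₀ hcb] at hT₁
      have h4 : 2 * M * v = (4 * M) / 2 * v := by ring
      rw [h4]
      have h5 : c * b₀ ^ 2 / 2 * (v ^ (2 * p₀ - 1) * v) = (v ^ (2 * p₀ - 1) * (c * b₀ ^ 2)) / 2 * v := by ring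
      rw [h5]
      exact mul_le_mul_of_nonneg_right (by linarith) hv0.le
    rw [hsplit₁]
    linarith
  -- rpow term: `κ v^q ≤ (c b₀²/2) v^{2p₀}`
  have hrp : κ * v ^ q ≤ c * b₀ ^ 2 / 2 * v ^ (2 * p₀) := by
    rw [div_le_iff₀ hcb] at hT₂
    rw [hsplit₂]
    have h5 : c * b₀ ^ 2 / 2 * (v ^ (2 * p₀ - q) * v ^ q) = (v ^ (2 * p₀ - q) * (c * b₀ ^ 2)) / 2 * v ^ q := by ring
    rw [h5]
    exact mul_le_mul_of_nonneg_right (by linarith) hvq0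
  rw [hsq]
  have h6 : c * (b₀ ^ 2 * v ^ (2 * p₀)) = c * b₀ ^ 2 / 2 * v ^ (2 * p₀) + c * b₀ ^ 2 / 2 * v ^ (2 * p₀) := by ring
  rw [h6]
  exact add_le_add hlin hrp

/-- **STUB 2 of LINE 20 — ABSORPTION RATE** (registered on crux stmt-QuantumFields-24027 `UnitPolyTailL` and on stmt-QuantumFields-19936,
skeleton `Cruxes/HistoryTailL/Lines/unit_poly_tail.lean`; proved EXACTLY as registered, with `s = 4`, `C' = C`): for admissible constants
(`0 < b₀`, `2 < p₀`, `0 < c`, `0 ≤ κ`, `q < 2p₀`, `0 ≤ C`, any `A`) the degraded-Gaussian large-field format is below `C'·γ^s` with some `s > 3`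
for all small `γ`: `C·γ^(−A)·exp(−c·p(√γ)² + κ·(1 + log(√γ)⁻¹)^q) ≤ C'·γ^s` for `0 < γ ≤ γ₀`, because `p(√γ)² = b₀²(1 + ½log γ⁻¹)^{2p₀}`
beats `κ(1 + ½log γ⁻¹)^q` (`q < 2p₀`) and `(A + 4)·log γ⁻¹` (`2p₀ > 4 > 1`).  The case `κ = 0 = A` is the landed
`CoarseStiffnessTailUnitPolyTailOfCount.exp_neg_pFun_sq_le_pow`.  Pure real analysis; nothing of [Balaban1985UV3] is proved and every crux
stays OPEN. [cite: Balaban1985UV3, (7) p.257] -/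
theorem stub_absorbRate :
    ∀ (b₀ p₀ c κ q A C : ℝ), 0 < b₀ → 2 < p₀ → 0 < c → 0 ≤ κ → q < 2 * p₀ → 0 ≤ C →
        ∃ (s C' γ₀ : ℝ), 3 < s ∧ 0 ≤ C' ∧ 0 < γ₀ ∧ γ₀ ≤ 1 ∧ ∀ γ : ℝ, 0 < γ → γ ≤ γ₀ →
          C * γ ^ (-A) * Real.exp (-(c * B10.pFun b₀ p₀ (Real.sqrt γ) ^ 2) + κ * (1 + Real.log (Real.sqrt γ)⁻¹) ^ q) ≤
            C' * γ ^ s := by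
  intro b₀ p₀ c κ q A C hb₀ hp₀ hc _hκ hq hC
  obtain ⟨v₀, hv₀1, hv₀⟩ := linear_add_rpow_le_sq κ A hb₀ hp₀ hc hq
  -- `γ₀ := exp(−2(v₀ − 1)) ≤ 1`; for `γ ≤ γ₀`: `v = 1 + (log γ⁻¹)/2 ≥ v₀`
  refine ⟨4, C, Real.exp (-(2 * (v₀ - 1))), by norm_num, hC, Real.exp_pos _,
    by rw [Real.exp_le_one_iff]; linarith, fun γ hγ hγle => ?_⟩
  set u : ℝ := Real.log γ⁻¹ with hudef
  have hlogγ : Real.log γ = -u := by rw [hudef, Real.log_inv, neg_neg]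
  have hu : 2 * (v₀ - 1) ≤ u := by
    have h1 : Real.log γ ≤ Real.log (Real.exp (-(2 * (v₀ - 1)))) := Real.log_le_log hγ hγle
    rw [Real.log_exp, hlogγ] at h1
    linarith
  set v : ℝ := 1 + u / 2 with hvdef
  have hvv₀ : v₀ ≤ v := by rw [hvdef]; linarith
  have huv : u = 2 * (v - 1) := by rw [hvdef]; ring
  -- rewrite every `γ`-expression in terms of `u`, `v`
  have hx : 1 + Real.log (Real.sqrt γ)⁻¹ = v := by
    rw [Real.log_inv, Real.log_sqrt hγ.le, hlogγ, hvdef]; ring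
  have hp : B10.pFun b₀ p₀ (Real.sqrt γ) = b₀ * v ^ p₀ := by
    rw [pFun_sqrt_eq hγ, hvdef]
  have hA : γ ^ (-A) = Real.exp (A * u) := by
    rw [Real.rpow_def_of_pos hγ, hlogγ]; ring_nf
  have h4 : γ ^ (4 : ℝ) = Real.exp (-(4 * u)) := by
    rw [Real.rpow_def_of_pos hγ, hlogγ]; ring_nf
  rw [hx, hp, hA, h4, mul_assoc, ← Real.exp_add]
  refine mul_le_mul_of_nonneg_left (Real.exp_le_exp.mpr ?_) hC
  have key := hv₀ v hvv₀
  rw [← huv] at key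
  linarith

end Summit.QuantumFields.YangMills.Theorems.CoarseStiffnessTailUnitPolyTailLAbsorbRate

end
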